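import Literature.Combinatorics.StablePolynomials.SymmetricDifferenceConvolution
import Literature.Combinatorics.StablePolynomials.SzaszCoefficientBound
import HarnessLib

/-!
# The multi-affine part operator preserves weak Hurwitz stability (Borcea–Brändén II, §8.4)

J. Borcea, P. Brändén, *The Lee–Yang and Pólya–Schur programs. II.*, Comm. Pure Appl. Math. 62 (2009)
1595–1631 (arXiv:0809.3087), §8.4:

> The linear operator `MAP : ℂ[z_1,…,z_n] → ℂ_{(1ⁿ)}[z_1,…,z_n]` extracts the multi-affine part of a polynomial,
> that is, if `f(z) = Σ_{α∈ℕⁿ} a(α) z^α` then `MAP(f)(z) = Σ_{α : α_i ≤ 1, i∈[n]} a(α) z^α`. The transcendental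
> symbol … of `MAP` is `Σ_{α : α_i ≤ 1} z^α w^α/α! = (1+zw)^{[n]}`. Clearly, this is a weakly Hurwitz stable
> polynomial. Theorem 7.1 and Remark 7.1 imply that `MAP` preserves weak Hurwitz stability.

(Theorem 7.1 is the transcendental characterisation of stability preservers on all of `ℂ[z]`, Remark 7.1 its
`H_{π/2}` version.) Here the conclusion — `MAP` maps every weakly Hurwitz (`H_{π/2}`-)stable polynomial to a weakly
Hurwitz stable polynomial or to `0` — is obtained from the *bounded degree* theorem instead (Theorem 3.2 for `C = H_{π/2}`,
`BorceaBranden_rightHalfPlaneStabilityPreserver_iff`, applied with `κ = deg f`): the algebraic symbol is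
`MAP[(1+zw)^κ] = Π_i (1 + κ_i z_i w_i)`, weakly Hurwitz stable since `z_iw_i ∉ (-∞,0]` for `z_i, w_i ∈ H_{π/2}`.
`MAP` is the tree's diagonal operator `mvMultiplierOp` with multiplier the indicator of square-free exponents.

## Contents

* `multiAffinePart`, `multiAffinePart_monomial`, `coeff_multiAffinePart`, `isMultiAffine_multiAffinePart`,
  `multiAffinePart_of_isMultiAffine`.
* `sum_range_indicator_choose_mul_pow` (`Σ_{a≤κ, a≤1} binom(κ,a) x^a = 1 + κx`), **`eval_multiAffinePart_symbol`**
  (`MAP[(1+zw)^κ](z) = Π_i(1+κ_iz_iw_i)`), `isHThetaStable_boundedDegreeSymbolD_multiAffinePart`,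
  **`multiAffinePart_weaklyHurwitzStable`** (`MAP` preserves weak Hurwitz stability).

## References

* [BorceaBranden2009II] J. Borcea, P. Brändén, Comm. Pure Appl. Math. 62 (2009) 1595–1631, §8.4 (the operator
  `MAP`).
-/

noncomputable section

open MvPolynomial Finset

namespace Literature.Combinatorics.StablePolynomials

variable {σ : Type*} [Fintype σ] [DecidableEq σ]

/-! ## §1 The operator `MAP` -/

section Def

/-- **`MAP`, the multi-affine part**: `Σ_α a(α) z^α ↦ Σ_{α ≤ 1} a(α) z^α` — the diagonal operator with
multiplier the indicator of square-free exponents. [cite: BorceaBranden2009II, §8.4 (definition of `MAP`)] -/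
def multiAffinePart : MvPolynomial σ ℂ →ₗ[ℂ] MvPolynomial σ ℂ :=
  mvMultiplierOp fun s => if ∀ i, s i ≤ 1 then 1 else 0

omit [DecidableEq σ] in
/-- `MAP` on a monomial. [cite: BorceaBranden2009II, §8.4 (definition of `MAP`)] -/
theorem multiAffinePart_monomial (s : σ →₀ ℕ) (c : ℂ) :
    multiAffinePart (monomial s c) = if ∀ i, s i ≤ 1 then monomial s c else 0 := by
  rw [multiAffinePart, mvMultiplierOp_monomial]
  split_ifs
  · rw [one_mul]
  · rw [zero_mul, monomial_zero]

omit [DecidableEq σ] in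
/-- **Coefficients of `MAP(f)`**: `[z^s] MAP(f) = [z^s] f` for square-free `s`, `0` otherwise.
[cite: BorceaBranden2009II, §8.4 (definition of `MAP`)] -/
theorem coeff_multiAffinePart (f : MvPolynomial σ ℂ) (s : σ →₀ ℕ) :
    coeff s (multiAffinePart f) = if ∀ i, s i ≤ 1 then coeff s f else 0 := by
  rw [multiAffinePart, coeff_mvMultiplierOp]
  split_ifs
  · rw [one_mul]
  · rw [zero_mul]

omit [DecidableEq σ] in
/-- `MAP(f)` is multi-affine (`MAP : ℂ[z] → ℂ_{(1ⁿ)}[z]`). [cite: BorceaBranden2009II, §8.4] -/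
theorem isMultiAffine_multiAffinePart (f : MvPolynomial σ ℂ) : IsMultiAffine (multiAffinePart f) := by
  rw [isMultiAffine_iff_support]
  intro s hs i
  by_contra h
  rw [mem_support_iff, coeff_multiAffinePart, if_neg (fun h' => h (h' i))] at hs
  exact hs rfl

omit [DecidableEq σ] in
/-- `MAP(f) = f` for multi-affine `f`. [cite: BorceaBranden2009II, §8.4] -/
theorem multiAffinePart_of_isMultiAffine {f : MvPolynomial σ ℂ} (hf : IsMultiAffine f) : multiAffinePart f = f := by
  ext s
  rw [coeff_multiAffinePart]
  split_ifs with h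
  · rfl
  · by_contra hne
    have hs : s ∈ f.support := mem_support_iff.2 (Ne.symm hne)
    exact h fun i => ((isMultiAffine_iff_support f).1 hf) s hs i

end Def

/-! ## §2 The symbol `MAP[(1+zw)^κ] = Π_i (1 + κ_i z_i w_i)` and weak Hurwitz stability -/

section Symbol

omit [Fintype σ] [DecidableEq σ] in
/-- `Σ_{a ≤ κ, a ≤ 1} binom(κ,a) x^a = 1 + κ x`. [cite: BorceaBranden2009II, §8.4 (the symbol of `MAP`)] -/
theorem sum_range_indicator_choose_mul_pow (κ : ℕ) (x : ℂ) :
    ∑ a ∈ range (κ + 1), (if a ≤ 1 then ((κ.choose a : ℕ) : ℂ) * x ^ a else 0) = 1 + κ * x := by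
  rcases Nat.eq_zero_or_pos κ with h | h
  · subst h
    simp
  · rw [← sum_subset (range_subset_range.2 (Nat.succ_le_succ h)) fun a _ ha => ?_]
    · simp [sum_range_succ]
    · rw [mem_range, not_lt] at ha
      rw [if_neg (by omega)]

/-- **The algebraic symbol of `MAP`**: `MAP[Π_i(1+w_iz_i)^{κ_i}](z) = Π_i (1 + κ_i w_i z_i)`.
[cite: BorceaBranden2009II, §8.4 (symbol of `MAP`: "`Σ_{α≤1} z^α w^α/α! = (1+zw)^{[n]}`", bounded-degree form)] -/
theorem eval_multiAffinePart_symbol (κ : σ → ℕ) (z w : σ → ℂ) :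
    eval z (multiAffinePart (∏ i, (1 + C (w i) * X i) ^ κ i)) = ∏ i, (1 + κ i * (w i * z i)) := by
  rw [apply_prod_one_add_C_mul_X_pow, map_sum]
  have hterm : ∀ α ∈ Fintype.piFinset (fun i => range (κ i + 1)),
      eval z ((∏ i, (((κ i).choose (α i) : ℕ) : ℂ) * w i ^ α i) • multiAffinePart (∏ i, X i ^ α i)) =
        ∏ i, (if α i ≤ 1 then (((κ i).choose (α i) : ℕ) : ℂ) * (w i * z i) ^ α i else 0) := by
    intro α _
    rw [multiAffinePart, mvMultiplierOp_prod_X_pow, smul_eval, smul_eval, _root_.map_prod]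
    simp only [toF_apply, map_pow, eval_X]
    by_cases h : ∀ i, α i ≤ 1
    · rw [if_pos h, one_mul, ← prod_mul_distrib]
      exact prod_congr rfl fun i _ => by rw [if_pos (h i), mul_pow]; ring
    · rw [if_neg h, zero_mul, mul_zero]
      push Not at h
      obtain ⟨i, hi⟩ := h
      exact (prod_eq_zero (mem_univ i) (if_neg (not_le.2 hi))).symm
  rw [sum_congr rfl hterm, ← prod_univ_sum (fun i => range (κ i + 1))
    fun i a => if a ≤ 1 then (((κ i).choose a : ℕ) : ℂ) * (w i * z i) ^ a else 0]
  exact prod_congr rfl fun i _ => sum_range_indicator_choose_mul_pow (κ i) (w i * z i)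

omit [Fintype σ] [DecidableEq σ] in
/-- `1 + κ u v ≠ 0` for `u, v ∈ H_{π/2}` and `κ ∈ ℕ`. [cite: BorceaBranden2009II, §8.4 ("clearly … weakly Hurwitz
stable")] -/
theorem one_add_natCast_mul_ne_zero_of_re_pos (κ : ℕ) {u v : ℂ} (hu : 0 < u.re) (hv : 0 < v.re) :
    1 + (κ : ℂ) * (u * v) ≠ 0 := by
  rcases Nat.eq_zero_or_pos κ with h | h
  · subst h
    simp
  · have hκv : 0 < ((κ : ℂ) * v).re := by
      rw [← Complex.ofReal_natCast, Complex.re_ofReal_mul]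
      exact mul_pos (Nat.cast_pos.2 h) hv
    have h2 := one_add_mul_ne_zero_of_re_pos hu hκv
    convert h2 using 1
    ring

/-- **The symbol `MAP[(1+zw)^κ]` is weakly Hurwitz stable.** [cite: BorceaBranden2009II, §8.4] -/
theorem isHThetaStable_boundedDegreeSymbolD_multiAffinePart (κ : σ → ℕ) :
    IsHThetaStable (Real.pi / 2) (boundedDegreeSymbolD κ (multiAffinePart (σ := σ))) := by
  rw [isHThetaStable_pi_div_two_iff]
  intro zw hzw
  rw [← Sum.elim_comp_inl_inr zw, eval_boundedDegreeSymbolD, eval_multiAffinePart_symbol]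
  exact prod_ne_zero_iff.2 fun i _ => one_add_natCast_mul_ne_zero_of_re_pos (κ i) (hzw _) (hzw _)

/-- **Borcea–Brändén II, §8.4: `MAP` preserves weak Hurwitz stability** — for every weakly Hurwitz
(`H_{π/2}`-)stable `f`, `MAP(f)` is weakly Hurwitz stable or identically `0` (Theorem 3.2 for `C = H_{π/2}` in
degree `κ = deg f`, symbol `Π_i(1+κ_iz_iw_i)`). [cite: BorceaBranden2009II, §8.4 ("`MAP` preserves weak Hurwitz
stability")] -/
theorem multiAffinePart_weaklyHurwitzStable {f : MvPolynomial σ ℂ} (hf : IsHThetaStable (Real.pi / 2) f) :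
    IsHThetaStable (Real.pi / 2) (multiAffinePart f) ∨ multiAffinePart f = 0 :=
  (BorceaBranden_rightHalfPlaneStabilityPreserver_iff (fun i => degreeOf i f) (multiAffinePart (σ := σ))).2
    (Or.inr (isHThetaStable_boundedDegreeSymbolD_multiAffinePart _)) f (fun _ => le_rfl) hf

end Symbol

end Literature.Combinatorics.StablePolynomials

end
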